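import Literature.MathematicalPhysics.QuantumFieldTheory.Balaban1983to89.B9Thm312WholeLeafRelHZM
import Literature.MathematicalPhysics.QuantumFieldTheory.Balaban1983to89.B9Thm312WholeLeafBlocksRegular
import Literature.MathematicalPhysics.QuantumFieldTheory.Balaban1983to89.B9Thm312WholeSeriesRegular
import Literature.MathematicalPhysics.QuantumFieldTheory.Balaban1983to89.B9Thm312WholeLeafCompletePairMBZ

/-!
# `Balaban1983to89.B9Thm312WholeLeafCompletePairMBZS` — [B9] Theorem 3.12 (p. 423) AS THE WHOLE PRINTED LEAF `B9.Thm312Printed`, PAIR-M FACE, WITH THE PERTURBATION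
# STEPS OVER A REGULAR STATE (LOCATED-U8′'s cure, row 20): `thm312Printed_completePairMBZ` with EVERY raw-state step hypothesis (`Step … 1∕2`, `LeftStep`, `StepDirB`)
# replaced by state-level objects — `StepS` on two state classes 𝔖₂ (dimension 2) ∕ 𝔖₁ (dimension 1), the one-step left-form members OUT OF them, the producers
# G₀ ∕ G₀Q\* ∕ G₀∇\*_U ∕ G₀∇\*_{U,μ} INTO them, their sup readings and ℓ¹-domination — from which the members of G AND G₁ follow by the first resolvent form

T. Bałaban, *Propagators for lattice gauge theories in a background field*, Commun. Math. Phys. **99** (1985) 389–434 [`Balaban1985BackgroundPropagators`,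
"B9"]; [4] = T. Bałaban, *Propagators and renormalization transformations for lattice gauge theories. II*, Commun. Math. Phys. **96** (1984) 223–250
[`Balaban1984PropagatorsII`].  statement-level skeleton of published theorems with citation tags; proofs where landed; nothing here is a claim about the
Yang–Mills mass gap.  Sequel of `B9Thm312WholeLeafCompletePairMBZ` (g12), `B9Thm312WholeLeafRelHZM`, `B9Thm312WholeBlocksRegular`, `B9Thm312WholeMembersRegular`,
`B9Thm312WholeSeriesRegular` (g27).

THE PRINT.  p. 422–423: the series (3.130)∕(3.138) converge «in all norms appearing on the left-hand sides of (3.42)–(3.47)»; derivatives in Δ′_π + Δ⁽²⁾_π «have to be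
applied either to the operator on the right, or on the left».  Print's induction state is REGULAR: every T = Δ′_π (+ Δ⁽²⁾_π) acts on a G₀-output carrying its Hölder sizes.

THE POINT (dag-n06-l LOCATED-U8 ∕ U8′, HOME `U8S-PROGRAMME-MEMO.md`).  The row-20 leaf of record derived the members of G₁, H₁ from one-step objects on the RAW class 𝔠⁽ᵖ⁾
(`Step.step1`, `LeftStep.stepD1`, `StepDirB.pY1 pX1 sDd1 pXd1 tDd1`), inhabited at the pins only through the four displayed Δ⁽²⁾ sup letters — beyond print at Δ⁽²⁾ ≠ 0.
THIS LEAF takes, per member and configuration in the regime, two FREE state classes 𝔖₂ i U (length-dimension 2: the class the entries G₀, G₀Q\* live in) and 𝔖₁ i U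
(dimension 1: G₀∇\*_U, G₀∇\*_{U,μ}) with: the steps `StepS` on both (θ_S·Mα₀, BOTH perturbations — g26 `stepS_of_lettersS`), the left-form one-step members out of them
(`hSD` ∇_UG₀T : 𝔖₂ → 𝔠_Y⁽¹⁾, `hPY` Φ^Y_β∇_UG₀T : 𝔖₂ → 𝔠_{PY}^{(β−1)}, `hSDd` ∇_{U,ν}G₀T : 𝔖₁ → 𝔠^{(0)}, `hPX` Φ^X_βG₀T : 𝔖₁ → 𝔠_{PX}^{(β−1)}, `hPXd` Φ^X_β∇_νG₀T : 𝔖₁ → 𝔠_{PX}^{(β)}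
— g27 `B9Thm312WholeStepDirRegular`, both perturbations), the producers (`hPG0 hPQs` INTO 𝔖₂, `hPDs hPDds` INTO 𝔖₁), the sup readings (`hRd2 hRd1`), the cutting-cost bound
`κ_S` and the ℓ¹-dominations (`hdom2 hdom1`, a-priori majorants) — and PROVES INSIDE, for A ∈ {G, G₁} alike: the right entries A, A∇\*, A∇\*_μ, H = A∘(Q\*C) IN the state
(g26 `hasMaj_right_of_stepS`), the six sup members and the (3.43)–(3.45) families (`B9Thm312WholeMembersRegular`), the L² block (`l2Block_of_members_pairM`), the Hölder block
(`ineq343_345_of_majorants_pairM`), the H-words and the Hölder member of (3.133) (`B9Thm312WholeBlocksRegular` §2), the convergence pins (`B9Thm312WholeSeriesRegular`), and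
closes by `thm312Printed_of_membersRelHZ`.  Conclusion `B9.Thm312Printed …` IDENTICAL to the leaf of record; NO raw-state step anywhere.
* ★★★ `thm312Printed_completePairMBZS`.
HONEST SCOPE.  Kernel-checked bookkeeping over hypothesis schemas of printed type (the state-level objects are inhabited at the pins from displayed∕derived members:
`e0 e1 e2 e1d e2d h43L h43R h43d h44m h45m hZ8 hpXDv gQs2 hpXQs h44G h43Gp hD2sup` + the Δ′_π letters); NOT a node discharge; COUNT-NEUTRAL; one finite lattice at a time —
nothing continuum ∕ ℝ⁴ ∕ OS ∕ mass gap.  Cell `pub-ymgap` (HUMAN RULING D-0062), Track A node N06 [B9], bundle F7 row 20, seat `pub-ymgap-dag-n06-l` (g27), 2026-08-29.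
-/

namespace Literature.MathematicalPhysics.QuantumFieldTheory.Balaban1983to89.B9Thm312WholeLeafCompletePairMBZS

open Literature.MathematicalPhysics.QuantumFieldTheory.Balaban1983to89
open Finset B6RandomWalk B6RandomWalkHom B9Thm34Ext B9Thm37Glue B9Thm37GlueCor36 B11SectG B9SectDSup B9SectDL2Decay
open B9Thm37AllNorms B9Thm37AllNormsInstances B9FromB6 B9FromB6ModelSignsOn B9SectBStepWhole B9Thm312Whole B9Thm312WholeLeaf
open B9Thm312WholeLeft B9Thm312WholeH B9Thm312WholeLeafLeftGlob B9Ineq347CoReading B9SectCDiffDict B9CoRealizesRel B9CoRealizesHRel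
open B9RWSums343Holder B9RWSumsReadsRel B9RWSumsReadsNbr B9Ineq347 B9Thm312WholeClasses B9Thm312WholeHolder B9Thm312WholeL2
open B9Thm312WholeBlocksRel B9Thm312WholeBlocksNbr B9Thm312WholeLeafAll B9Thm312WholeHHolder B9Thm312WholeHHolderNbr B9Thm312WholeLeafRelH
open B9RWSums346SecondDiff B9Thm312WholeLeafCompleteNbr B9Thm312WholeBlocksNbrRec B9RWSums344InputFam B9Thm312WholeDir
open B9Thm312WholeBlocksPairM B9Thm312WholeLeafCompletePairM B9Thm312WholeDirB B9Thm312WholeBlocksPairMB B9Thm312WholeHZ B9Thm312WholeLeafRelHZ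
open B9Thm312WholeStepRegular B9Thm312WholeStepDirRegular B9Thm312WholeMembersRegular B9Thm312WholeBlocksRegular B9Thm312WholeSeriesRegular
open B9Thm312WholeLeafRelHZM B9Thm312WholeLeafBlocksRegular B9Thm313WholeHolder

noncomputable section

section Family

variable {I : Type} {d : ℕ} {c35 : ℝ} {geo : I → B9.Geometry} {bg : I → B9.Backgrounds}
variable [∀ i, Fintype (geo i).Site] [∀ i, DecidableEq (geo i).Site]
variable {X Y Z W PX PY : I → Type} {P : Type} [∀ i, Fintype (X i)] [∀ i, DecidableEq (X i)] [∀ i, Fintype (Y i)]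
  [∀ i, Fintype (Z i)] [∀ i, Fintype (W i)] [∀ i, Fintype (PX i)] [∀ i, Fintype (PY i)] [Fintype P]

omit [∀ i, Fintype (X i)] [∀ i, DecidableEq (X i)] [∀ i, Fintype (Y i)] [∀ i, Fintype (Z i)] [∀ i, Fintype (W i)]
  [∀ i, Fintype (geo i).Site] [∀ i, DecidableEq (geo i).Site] [∀ i, Fintype (PX i)] [∀ i, Fintype (PY i)] [Fintype P] in
/-- Arithmetic of *"for α₀ sufficiently small"*: t ≧ 0 and m ≦ (2(t + 1))⁻¹ give tm ≦ ½. [folklore] -/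
private theorem small_auxS {t m : ℝ} (ht : 0 ≤ t) (hm : m ≤ (2 * (t + 1))⁻¹) : t * m ≤ 1 / 2 := by
  have hpos : 0 < 2 * (t + 1) := by linarith
  have h1 : t * m ≤ t * (2 * (t + 1))⁻¹ := mul_le_mul_of_nonneg_left hm ht
  have h2 : t * (2 * (t + 1))⁻¹ ≤ 1 / 2 := by
    rw [← div_eq_mul_inv, div_le_iff₀ hpos]
    linarith
  linarith

set_option maxHeartbeats 400000 in
/-- ★★★ **THEOREM 3.12 AS THE WHOLE PRINTED LEAF `B9.Thm312Printed`, PAIR-M FACE, STEPS OVER A REGULAR STATE** (p. 423; the cure of LOCATED-U8′).  Inputs: those of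
`thm312Printed_completePairMBZ` except that `hmodel` keeps only `FormSmall ∧ Identities`, `hleft` keeps only Theorem 3.3's (3.42)₂ `he1`, `hstepC` keeps only the block-L² step
`StepL2`, and the raw-state steps are REPLACED by the state-level families `hstate2` (on 𝔖₂: `StepS`, ∇_UG₀T, Φ^Y_β∇_UG₀T out of 𝔖₂; G₀, G₀Q\* INTO 𝔖₂; the sup reading
`id : 𝔖₂ → 𝔠^{(−2)}`; κ ≦ κ_S; ℓ¹-domination) and `hstate1` (on 𝔖₁: `StepS`, ∇_{U,ν}G₀T, Φ^X_βG₀T, Φ^X_β∇_νG₀T out of 𝔖₁; G₀∇\*_U, G₀∇\*_{U,μ} (out of `bHX ε`, constant A_I(ε)) INTO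
𝔖₁; `id : 𝔖₁ → 𝔠^{(−1)}`; κ ≦ κ_S; ℓ¹-domination) plus the domination of the sharp sup class by the input classes (`hdomX`).  PROVED INSIDE: everything (see the module
docstring).  Output families: B(β) = max(m·CL·e^{rρ_f}(B_h β + κ_Sθ_H β·a₁·2A₀·c), C_H3·(B_qB₃c + κ_Sθ_H β·a₁·2B₃²c·c)·Lc², 0), B′(ε) = max(e^{rρ_f}(B_i ε + κ_Sθ_D·a₁·2A_I ε·c), 0),
B′(ε,β) = max(CL·e^{rρ_f}(B_i2 ε β + κ_Sθ_H β·a₁·2A_I(β+ε)·c), 0).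
[cite: Balaban1985BackgroundPropagators, Thm 3.12 pp.421–423 + (3.39)–(3.47) pp.397–398 + (3.126) p.420 + (3.129) p.421 + (3.132)–(3.133) p.422; Balaban1984PropagatorsII, (2.51)–(2.52) p.232 + Lemma 2.1 (2.60)–(2.61) p.234 + (2.66) p.234] -/
theorem thm312Printed_completePairMBZS (𝔬 : ∀ i, Ops (geo i) (bg i) (X i) (Y i) (Z i) (W i)) (R₀ : I → ℝ) (H₀ : I → Prop)
    (𝔭 : ∀ i, HolderProbes (geo i) (bg i) (X i) (Y i) (PX i) (PY i))
    (bHX : ∀ i, ℝ → BlockNorm (toB6 (geo i) (R₀ i) (H₀ i)) (X i → ℝ))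
    (Dd Dds : ∀ i, (bg i).Cfg → P → Module.End ℝ (X i → ℝ))
    (GD G₁ : ∀ i, B9.KernelFamily (geo i) (bg i)) (Hk H₁k : ∀ i, B9.HKernel (geo i) (bg i))
    (ev : ∀ i, (geo i).Loc → X i → ℝ) (evY : ∀ i, (geo i).Loc → Y i → ℝ) {PL : ∀ i, (geo i).Loc → Prop}
    (Rel : ∀ i, (geo i).Site → (geo i).Site → Prop) [∀ i, DecidableRel (Rel i)] (m mN : ℕ)
    (𝔖₂ 𝔖₁ : ∀ i, (bg i).Cfg → BlockNorm (toB6 (geo i) (R₀ i) (H₀ i)) (X i → ℝ))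
    (r Cev CL θS θD θ₂ r₁ B₀ B₂ δ₀ δK σ c ρ ρf a₁ M₁ ML B₃ δ₃ α Lc κS A₀ CR : ℝ) (Bh Bi Bq θH AI : ℝ → ℝ) (Bi2 : ℝ → ℝ → ℝ)
    (hθS : 0 ≤ θS) (hθD : 0 ≤ θD) (hθH : ∀ β, 0 ≤ β → β < 1 → 0 ≤ θH β) (hθ₂ : 0 ≤ θ₂) (hr₁ : 0 ≤ r₁) (hB₀ : 0 ≤ B₀) (hB₂ : 0 ≤ B₂) (hB₃ : 0 ≤ B₃)
    (hκS : 1 ≤ κS) (hA₀ : 0 ≤ A₀) (hCR : 0 ≤ CR) (hAI : ∀ ε, 0 < ε → 0 ≤ AI ε)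
    (hσ : 0 ≤ σ) (hρ : 0 < ρ) (hρS : ρ + 2 * σ ≤ δ₀) (hρδ : ρ + 2 * σ ≤ δK) (hρ₃ : ρ + 2 * σ ≤ δ₃) (hc : 0 ≤ c) (ha₁ : 0 < a₁) (hM₁ : 0 < M₁)
    (hα : α ≤ 1 / 2) (hα0 : 0 ≤ α) (hρf : 0 < ρf) (hρf1 : ρf + σ ≤ (1 - α) * ρ) (hρf2 : ρf + 2 * σ + α * ρ ≤ ρ)
    (hBh : ∀ β, 0 ≤ β → β < 1 → 0 ≤ Bh β) (hBi : ∀ ε, 0 < ε → ε ≤ 1 → 0 ≤ Bi ε)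
    (hBi2 : ∀ ε β, 0 < ε → ε ≤ 1 → 0 ≤ β → β < 1 → 0 ≤ Bi2 ε β) (hBq : ∀ β, 0 ≤ Bq β)
    (hCev : 0 ≤ Cev) (hCL1 : 1 ≤ CL)
    (hgeo : ∀ i, GeoOK (geo i)) (S : ∀ i, ModelSignsOn (geo i) (PL i))
    (hL1 : ∀ i, 1 ≤ (geo i).L) (hLle : ∀ i, (geo i).L ≤ Lc) (hLc : 1 ≤ Lc) (hη : ∀ i, 0 < (geo i).eta)
    (hrow : ∀ i, ML ≤ (geo i).M → RowSum (toB6 (geo i) (R₀ i) (H₀ i)) σ c)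
    (hL21 : ∀ δ : ℝ, 0 < δ → ∃ ML' c' : ℝ, Lemma21AboveG geo R₀ H₀ δ α ML' c')
    (hnbr : ∀ (i : I) (y : (geo i).Site), (nbr (geo i) r y).card ≤ mN)
    (hCL : ∀ (i : I) (a a' : (geo i).Site), (geo i).dist a a' ≤ r → (geo i).len a ≤ CL * (geo i).len a')
    (hsat : ∀ (i : I) (n : Fin 4) (B' δ' : ℝ),
      (∀ a a' b, Rel i a a' → maj342 (geo i) n B' δ' a b = maj342 (geo i) n B' δ' a' b) ∧
      (∀ a b b', Rel i b b' → maj342 (geo i) n B' δ' a b = maj342 (geo i) n B' δ' a b'))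
    (hmult : ∀ (i : I) (y' : (geo i).Site), (Finset.univ.filter (fun y'' => Rel i y'' y')).card ≤ m)
    (hRdist : ∀ (i : I) (a a' b : (geo i).Site), Rel i a a' → (geo i).dist a b = (geo i).dist a' b)
    (hRlen : ∀ (i : I) (a a' : (geo i).Site), Rel i a a' → (geo i).len a = (geo i).len a')
    (hcoR : ∀ (i : I) (U : (bg i).Cfg),
      CoRealizesRel (GD i) 0 U (Rel i) (𝔬 i).blk (𝔬 i).blk (ev i) ((𝔬 i).G U) ∧
      CoRealizesRel (GD i) 2 U (Rel i) (𝔬 i).blk (𝔬 i).blkY (evY i) ((𝔬 i).G U ∘ₗ (𝔬 i).Dstar U) ∧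
      CoRealizesRel (G₁ i) 0 U (Rel i) (𝔬 i).blk (𝔬 i).blk (ev i) ((𝔬 i).G1 U) ∧
      CoRealizesRel (G₁ i) 2 U (Rel i) (𝔬 i).blk (𝔬 i).blkY (evY i) ((𝔬 i).G1 U ∘ₗ (𝔬 i).Dstar U))
    (hco1R : ∀ (i : I) (U : (bg i).Cfg),
      CoRealizesRel (GD i) 1 U (Rel i) (𝔬 i).blkY (𝔬 i).blk (ev i) ((𝔬 i).D U ∘ₗ (𝔬 i).G U) ∧
      CoRealizesRel (G₁ i) 1 U (Rel i) (𝔬 i).blkY (𝔬 i).blk (ev i) ((𝔬 i).D U ∘ₗ (𝔬 i).G1 U))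
    (hcoHR : ∀ (i : I) (U : (bg i).Cfg),
      CoRealizesHRel (Hk i) 0 U d (Rel i) (𝔬 i).blk (𝔬 i).blkZ ((𝔬 i).Hm U) ∧
      CoRealizesHRel (Hk i) 1 U d (Rel i) (𝔬 i).blkY (𝔬 i).blkZ ((𝔬 i).D U ∘ₗ (𝔬 i).Hm U) ∧
      CoRealizesHRel (H₁k i) 0 U d (Rel i) (𝔬 i).blk (𝔬 i).blkZ ((𝔬 i).H1m U) ∧
      CoRealizesHRel (H₁k i) 1 U d (Rel i) (𝔬 i).blkY (𝔬 i).blkZ ((𝔬 i).D U ∘ₗ (𝔬 i).H1m U))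
    (hcoG : ∀ (i : I) (U : (bg i).Cfg),
      CoReadsGlob (GD i) 0 U (𝔬 i).blk (𝔬 i).blk (ev i) ((𝔬 i).G U) ∧
      CoReadsGlob (GD i) 1 U (𝔬 i).blkY (𝔬 i).blk (ev i) ((𝔬 i).D U ∘ₗ (𝔬 i).G U) ∧
      CoReadsGlob (GD i) 2 U (𝔬 i).blk (𝔬 i).blkY (evY i) ((𝔬 i).G U ∘ₗ (𝔬 i).Dstar U) ∧
      CoReadsGlob (G₁ i) 0 U (𝔬 i).blk (𝔬 i).blk (ev i) ((𝔬 i).G1 U) ∧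
      CoReadsGlob (G₁ i) 1 U (𝔬 i).blkY (𝔬 i).blk (ev i) ((𝔬 i).D U ∘ₗ (𝔬 i).G1 U) ∧
      CoReadsGlob (G₁ i) 2 U (𝔬 i).blk (𝔬 i).blkY (evY i) ((𝔬 i).G1 U ∘ₗ (𝔬 i).Dstar U))
    (hl2N : ∀ (i : I) (U : (bg i).Cfg),
      (L2ReadsNbr (R := R₀ i) (H := H₀ i) (GD i) 0 U (Rel i) r Cev (𝔬 i).blk (𝔬 i).blk (ev i) ((𝔬 i).G U) ∧
        L2ReadsNbr (R := R₀ i) (H := H₀ i) (GD i) 1 U (Rel i) r Cev (𝔬 i).blkY (𝔬 i).blk (ev i) ((𝔬 i).D U ∘ₗ (𝔬 i).G U) ∧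
        L2ReadsNbr (R := R₀ i) (H := H₀ i) (GD i) 2 U (Rel i) r Cev (𝔬 i).blk (𝔬 i).blkY (evY i) ((𝔬 i).G U ∘ₗ (𝔬 i).Dstar U) ∧
        L2ReadsNbr (R := R₀ i) (H := H₀ i) (GD i) 3 U (Rel i) r Cev ((𝔬 i).blk ∘ Prod.fst) (𝔬 i).blk (ev i)
          (familyOp (fun q : P × P => Dd i U q.1 ∘ₗ ((𝔬 i).G U ∘ₗ Dds i U q.2))) ∧
        L2ReadsNbr (R := R₀ i) (H := H₀ i) (GD i) 4 U (Rel i) r Cev ((𝔬 i).blk ∘ Prod.fst) (𝔬 i).blk (ev i)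
          (familyOp (fun q : P × P => (Dd i U q.1 ∘ₗ Dd i U q.2) ∘ₗ (𝔬 i).G U)) ∧
        L2ReadsNbr (R := R₀ i) (H := H₀ i) (GD i) 5 U (Rel i) r Cev ((𝔬 i).blk ∘ Prod.fst) (𝔬 i).blk (ev i)
          (familyOp (fun q : P × P => (𝔬 i).G U ∘ₗ (Dds i U q.1 ∘ₗ Dds i U q.2)))) ∧
      (L2ReadsNbr (R := R₀ i) (H := H₀ i) (G₁ i) 0 U (Rel i) r Cev (𝔬 i).blk (𝔬 i).blk (ev i) ((𝔬 i).G1 U) ∧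
        L2ReadsNbr (R := R₀ i) (H := H₀ i) (G₁ i) 1 U (Rel i) r Cev (𝔬 i).blkY (𝔬 i).blk (ev i) ((𝔬 i).D U ∘ₗ (𝔬 i).G1 U) ∧
        L2ReadsNbr (R := R₀ i) (H := H₀ i) (G₁ i) 2 U (Rel i) r Cev (𝔬 i).blk (𝔬 i).blkY (evY i) ((𝔬 i).G1 U ∘ₗ (𝔬 i).Dstar U) ∧
        L2ReadsNbr (R := R₀ i) (H := H₀ i) (G₁ i) 3 U (Rel i) r Cev ((𝔬 i).blk ∘ Prod.fst) (𝔬 i).blk (ev i)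
          (familyOp (fun q : P × P => Dd i U q.1 ∘ₗ ((𝔬 i).G1 U ∘ₗ Dds i U q.2))) ∧
        L2ReadsNbr (R := R₀ i) (H := H₀ i) (G₁ i) 4 U (Rel i) r Cev ((𝔬 i).blk ∘ Prod.fst) (𝔬 i).blk (ev i)
          (familyOp (fun q : P × P => (Dd i U q.1 ∘ₗ Dd i U q.2) ∘ₗ (𝔬 i).G1 U)) ∧
        L2ReadsNbr (R := R₀ i) (H := H₀ i) (G₁ i) 5 U (Rel i) r Cev ((𝔬 i).blk ∘ Prod.fst) (𝔬 i).blk (ev i)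
          (familyOp (fun q : P × P => (𝔬 i).G1 U ∘ₗ (Dds i U q.1 ∘ₗ Dds i U q.2)))))
    (hH1N : ∀ (i : I) (U : (bg i).Cfg),
      H1ReadsNbr (GD i) U (𝔭 i) (Rel i) r (𝔬 i).blk (𝔬 i).blkY (ev i) (evY i) ((𝔬 i).D U ∘ₗ (𝔬 i).G U)
        ((𝔬 i).G U ∘ₗ (𝔬 i).Dstar U) ∧
      H1ReadsNbr (G₁ i) U (𝔭 i) (Rel i) r (𝔬 i).blk (𝔬 i).blkY (ev i) (evY i) ((𝔬 i).D U ∘ₗ (𝔬 i).G1 U)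
        ((𝔬 i).G1 U ∘ₗ (𝔬 i).Dstar U))
    (hIF : ∀ (i : I) (U : (bg i).Cfg),
      InputReadsFam (GD i) U (bHX i) r ((𝔬 i).blk ∘ Prod.fst) ((𝔭 i).blkPX ∘ Prod.fst) (fun β => sliceProbe ((𝔭 i).ΦX U β)) (ev i)
        (familyOp (fun q : P × P => Dd i U q.1 ∘ₗ ((𝔬 i).G U ∘ₗ Dds i U q.2))) ∧
      InputReadsFam (G₁ i) U (bHX i) r ((𝔬 i).blk ∘ Prod.fst) ((𝔭 i).blkPX ∘ Prod.fst) (fun β => sliceProbe ((𝔭 i).ΦX U β)) (ev i)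
        (familyOp (fun q : P × P => Dd i U q.1 ∘ₗ ((𝔬 i).G1 U ∘ₗ Dds i U q.2))))
    (hHCN : ∀ (i : I) (U : (bg i).Cfg),
      CoReadsHHolderNbr (Hk i) U d (𝔭 i) r (𝔬 i).blkZ ((𝔬 i).D U ∘ₗ (𝔬 i).Hm U) ∧
      CoReadsHHolderNbr (H₁k i) U d (𝔭 i) r (𝔬 i).blkZ ((𝔬 i).D U ∘ₗ (𝔬 i).H1m U))
    (hsym : ∀ i, M₁ ≤ (geo i).M → ∀ α₀ : ℝ, 0 < α₀ → (geo i).M * α₀ ≤ a₁ →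
      ∀ U : (bg i).Cfg, (bg i).Reg335 c35 α₀ U → (bg i).Reg336 c35 α₀ U →
        (IsTransposePair ((𝔬 i).G U) ((𝔬 i).G U) ∧ IsTransposePair ((𝔬 i).G1 U) ((𝔬 i).G1 U)) ∧
        (IsTransposePair ((𝔬 i).D U ∘ₗ (𝔬 i).G U) ((𝔬 i).G U ∘ₗ (𝔬 i).Dstar U) ∧
          IsTransposePair ((𝔬 i).D U ∘ₗ (𝔬 i).G1 U) ((𝔬 i).G1 U ∘ₗ (𝔬 i).Dstar U)))
    (hmodel : ∀ i, M₁ ≤ (geo i).M → ∀ α₀ : ℝ, 0 < α₀ → (geo i).M * α₀ ≤ a₁ →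
      ∀ U : (bg i).Cfg, (bg i).Reg335 c35 α₀ U → (bg i).Reg336 c35 α₀ U →
        FormSmall (𝔬 i) (r₁ * ((geo i).M * α₀)) U ∧ Identities (𝔬 i) U)
    (he1 : ∀ i, M₁ ≤ (geo i).M → ∀ α₀ : ℝ, 0 < α₀ → (geo i).M * α₀ ≤ a₁ →
      ∀ U : (bg i).Cfg, (bg i).Reg335 c35 α₀ U → (bg i).Reg336 c35 α₀ U →
        HasMajorantHom (g := toB6 (geo i) (R₀ i) (H₀ i)) (𝔬 i).blk (𝔬 i).blkY ((𝔬 i).D U ∘ₗ (𝔬 i).G0 U)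
          (fun (a b : (geo i).Site) => B₀ * (geo i).len a * Real.exp (-(δ₀ * (geo i).dist a b))))
    (bZ : ∀ i, BlockNorm (toB6 (geo i) (R₀ i) (H₀ i)) (Z i → ℝ)) (hκZ : ∀ i, (bZ i).κ = 1)
    (hlettersH : ∀ i, M₁ ≤ (geo i).M → ∀ α₀ : ℝ, 0 < α₀ → (geo i).M * α₀ ≤ a₁ →
      ∀ U : (bg i).Cfg, (bg i).Reg335 c35 α₀ U → (bg i).Reg336 c35 α₀ U →
        LettersHZ (𝔬 i) (R₀ i) (H₀ i) (hgeo i) (bZ i) B₃ δ₃ U)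
    (hG0C : ∀ i, M₁ ≤ (geo i).M → ∀ α₀ : ℝ, 0 < α₀ → (geo i).M * α₀ ≤ a₁ →
      ∀ U : (bg i).Cfg, (bg i).Reg335 c35 α₀ U → (bg i).Reg336 c35 α₀ U →
        Thm33G0Dir (𝔬 i) (𝔭 i) (Dd i) (Dds i) (R₀ i) (H₀ i) (bHX i) B₀ Bh Bi Bi2 δ₀ U ∧
          Thm33G0L2M (𝔬 i) (Dd i) (Dds i) (R₀ i) (H₀ i) B₂ δ₀ U)
    (hStL : ∀ i, M₁ ≤ (geo i).M → ∀ α₀ : ℝ, 0 < α₀ → (geo i).M * α₀ ≤ a₁ →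
      ∀ U : (bg i).Cfg, (bg i).Reg335 c35 α₀ U → (bg i).Reg336 c35 α₀ U →
        StepL2 (𝔬 i) (R₀ i) (H₀ i) (θ₂ * ((geo i).M * α₀)) δK U)
    (hLHH : ∀ i, M₁ ≤ (geo i).M → ∀ α₀ : ℝ, 0 < α₀ → (geo i).M * α₀ ≤ a₁ →
      ∀ U : (bg i).Cfg, (bg i).Reg335 c35 α₀ U → (bg i).Reg336 c35 α₀ U →
        LettersHHZ (𝔬 i) (𝔭 i) (R₀ i) (H₀ i) (hgeo i).lenle (bZ i) Bq δ₃ U)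
    (hdomX : ∀ (i : I) (ε : ℝ), 0 < ε → (∀ y μ, (BlockNorm.ofBlocks (toB6 (geo i) (R₀ i) (H₀ i)) (𝔬 i).blk).loc y μ ≤ (bHX i ε).loc y μ) ∧
      (∀ y μ, (bHX i ε).IsLoc y μ → (BlockNorm.ofBlocks (toB6 (geo i) (R₀ i) (H₀ i)) (𝔬 i).blk).IsLoc y μ))
    (hstate2 : ∀ i, M₁ ≤ (geo i).M → ∀ α₀ : ℝ, 0 < α₀ → (geo i).M * α₀ ≤ a₁ →
      ∀ U : (bg i).Cfg, (bg i).Reg335 c35 α₀ U → (bg i).Reg336 c35 α₀ U →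
        StepS (𝔬 i) (𝔖₂ i U) (θS * ((geo i).M * α₀)) δK U ∧
        (HasMaj (𝔖₂ i U) (cNorm (R₀ i) (H₀ i) (𝔬 i).blkY (hgeo i).lenle 1) ((𝔬 i).D U ∘ₗ (𝔬 i).G0 U ∘ₗ (𝔬 i).Tpi U)
            (fun a b => θD * ((geo i).M * α₀) * Real.exp (-(δK * (geo i).dist a b))) ∧
          HasMaj (𝔖₂ i U) (cNorm (R₀ i) (H₀ i) (𝔬 i).blkY (hgeo i).lenle 1) ((𝔬 i).D U ∘ₗ (𝔬 i).G0 U ∘ₗ ((𝔬 i).Tpi U + (𝔬 i).T2 U))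
            (fun a b => θD * ((geo i).M * α₀) * Real.exp (-(δK * (geo i).dist a b)))) ∧
        (∀ β : ℝ, 0 ≤ β → β < 1 →
          HasMaj (𝔖₂ i U) (cNormR (R₀ i) (H₀ i) (𝔭 i).blkPY (hgeo i).lenle (β - 1)) (((𝔭 i).ΦY U β ∘ₗ (𝔬 i).D U ∘ₗ (𝔬 i).G0 U) ∘ₗ (𝔬 i).Tpi U)
              (fun a b => θH β * ((geo i).M * α₀) * Real.exp (-(δK * (geo i).dist a b))) ∧
            HasMaj (𝔖₂ i U) (cNormR (R₀ i) (H₀ i) (𝔭 i).blkPY (hgeo i).lenle (β - 1))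
              (((𝔭 i).ΦY U β ∘ₗ (𝔬 i).D U ∘ₗ (𝔬 i).G0 U) ∘ₗ ((𝔬 i).Tpi U + (𝔬 i).T2 U))
              (fun a b => θH β * ((geo i).M * α₀) * Real.exp (-(δK * (geo i).dist a b)))) ∧
        HasMaj (cNorm (R₀ i) (H₀ i) (𝔬 i).blk (hgeo i).lenle 0) (𝔖₂ i U) ((𝔬 i).G0 U)
          (fun a b => A₀ * Real.exp (-(δ₀ * (geo i).dist a b))) ∧
        HasMaj (bZ i) (𝔖₂ i U) ((𝔬 i).G0 U ∘ₗ (𝔬 i).Qstar U) (fun a b => B₃ * Real.exp (-(δ₃ * (geo i).dist a b))) ∧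
        HasMaj (𝔖₂ i U) (cNormR (R₀ i) (H₀ i) (𝔬 i).blk (hgeo i).lenle (-2)) LinearMap.id
          (fun a b => CR * Real.exp (-(δ₀ * (geo i).dist a b))) ∧
        (𝔖₂ i U).κ ≤ κS ∧
        (∃ Λ : ℝ, 0 ≤ Λ ∧ ∀ (y : (geo i).Site) (F : X i → ℝ), (𝔖₂ i U).loc y F ≤ Λ * ∑ x : X i, |F x|))
    (hstate1 : ∀ i, M₁ ≤ (geo i).M → ∀ α₀ : ℝ, 0 < α₀ → (geo i).M * α₀ ≤ a₁ →
      ∀ U : (bg i).Cfg, (bg i).Reg335 c35 α₀ U → (bg i).Reg336 c35 α₀ U →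
        StepS (𝔬 i) (𝔖₁ i U) (θS * ((geo i).M * α₀)) δK U ∧
        (∀ ν : P,
          HasMaj (𝔖₁ i U) (cNormR (R₀ i) (H₀ i) (𝔬 i).blk (hgeo i).lenle 0) (Dd i U ν ∘ₗ (𝔬 i).G0 U ∘ₗ (𝔬 i).Tpi U)
              (fun a b => θD * ((geo i).M * α₀) * Real.exp (-(δK * (geo i).dist a b))) ∧
            HasMaj (𝔖₁ i U) (cNormR (R₀ i) (H₀ i) (𝔬 i).blk (hgeo i).lenle 0) (Dd i U ν ∘ₗ (𝔬 i).G0 U ∘ₗ ((𝔬 i).Tpi U + (𝔬 i).T2 U))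
              (fun a b => θD * ((geo i).M * α₀) * Real.exp (-(δK * (geo i).dist a b)))) ∧
        (∀ β : ℝ, 0 ≤ β → β < 1 →
          HasMaj (𝔖₁ i U) (cNormR (R₀ i) (H₀ i) (𝔭 i).blkPX (hgeo i).lenle (β - 1)) (((𝔭 i).ΦX U β ∘ₗ (𝔬 i).G0 U) ∘ₗ (𝔬 i).Tpi U)
              (fun a b => θH β * ((geo i).M * α₀) * Real.exp (-(δK * (geo i).dist a b))) ∧
            HasMaj (𝔖₁ i U) (cNormR (R₀ i) (H₀ i) (𝔭 i).blkPX (hgeo i).lenle (β - 1)) (((𝔭 i).ΦX U β ∘ₗ (𝔬 i).G0 U) ∘ₗ ((𝔬 i).Tpi U + (𝔬 i).T2 U))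
              (fun a b => θH β * ((geo i).M * α₀) * Real.exp (-(δK * (geo i).dist a b)))) ∧
        (∀ (ν : P) (β : ℝ), 0 ≤ β → β < 1 →
          HasMaj (𝔖₁ i U) (cNormR (R₀ i) (H₀ i) (𝔭 i).blkPX (hgeo i).lenle β) (((𝔭 i).ΦX U β ∘ₗ Dd i U ν ∘ₗ (𝔬 i).G0 U) ∘ₗ (𝔬 i).Tpi U)
              (fun a b => θH β * ((geo i).M * α₀) * Real.exp (-(δK * (geo i).dist a b))) ∧
            HasMaj (𝔖₁ i U) (cNormR (R₀ i) (H₀ i) (𝔭 i).blkPX (hgeo i).lenle β) (((𝔭 i).ΦX U β ∘ₗ Dd i U ν ∘ₗ (𝔬 i).G0 U) ∘ₗ ((𝔬 i).Tpi U + (𝔬 i).T2 U))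
              (fun a b => θH β * ((geo i).M * α₀) * Real.exp (-(δK * (geo i).dist a b)))) ∧
        HasMaj (cNormR (R₀ i) (H₀ i) (𝔬 i).blkY (hgeo i).lenle 0) (𝔖₁ i U) ((𝔬 i).G0 U ∘ₗ (𝔬 i).Dstar U)
          (fun a b => A₀ * Real.exp (-(δ₀ * (geo i).dist a b))) ∧
        (∀ (μ : P) (ε : ℝ), 0 < ε → HasMaj (bHX i ε) (𝔖₁ i U) ((𝔬 i).G0 U ∘ₗ Dds i U μ)
          (fun a b => AI ε * Real.exp (-(δ₀ * (geo i).dist a b)))) ∧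
        HasMaj (𝔖₁ i U) (cNormR (R₀ i) (H₀ i) (𝔬 i).blk (hgeo i).lenle (-1)) LinearMap.id
          (fun a b => CR * Real.exp (-(δ₀ * (geo i).dist a b))) ∧
        (𝔖₁ i U).κ ≤ κS ∧
        (∃ Λ : ℝ, 0 ≤ Λ ∧ ∀ (y : (geo i).Site) (F : X i → ℝ), (𝔖₁ i U).loc y F ≤ Λ * ∑ x : X i, |F x|)) :
    B9.Thm312Printed d c35 geo bg GD G₁ Hk H₁k (fun i => HasRWExpOfOps (𝔬 i)) (fun i => HasRWExpHOfOps (𝔬 i))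
      (fun i => PosDefKOfOps (𝔬 i)) := by
  -- thresholds and uniform constants
  obtain ⟨MLg, cg, hLg⟩ := hL21 ρ hρ
  set M₁' : ℝ := max (max M₁ ML) MLg with hM₁'
  have hM₁'pos : 0 < M₁' := lt_max_of_lt_left (lt_max_of_lt_left hM₁)
  have hle₁ : ∀ {i : I}, M₁' ≤ (geo i).M → M₁ ≤ (geo i).M := fun h => ((le_max_left _ _).trans (le_max_left _ _)).trans h
  have hleL : ∀ {i : I}, M₁' ≤ (geo i).M → ML ≤ (geo i).M := fun h => ((le_max_right _ _).trans (le_max_left _ _)).trans h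
  have hleg : ∀ {i : I}, M₁' ≤ (geo i).M → MLg ≤ (geo i).M := fun h => (le_max_right _ _).trans h
  have hκS0 : 0 ≤ κS := zero_le_one.trans hκS
  have hκθc : 0 ≤ κS * θS * c := mul_nonneg (mul_nonneg hκS0 hθS) hc
  have hB₂c : 0 ≤ B₂ * θ₂ * c * c := mul_nonneg (mul_nonneg (mul_nonneg hB₂ hθ₂) hc) hc
  set a₁' : ℝ := min a₁ (min (2 * (κS * θS * c + 1))⁻¹ (2 * (B₂ * θ₂ * c * c + 1))⁻¹) with ha₁'
  have ha₁'pos : 0 < a₁' := lt_min ha₁ (lt_min (inv_pos.mpr (by linarith)) (inv_pos.mpr (by linarith)))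
  have ha₁'le : a₁' ≤ a₁ := min_le_left _ _
  have hLc0 : 0 ≤ Lc := zero_le_one.trans hLc
  have hLc2 : 0 ≤ Lc ^ (2 : ℝ) := Real.rpow_nonneg hLc0 _
  set Λu : ℝ := Lc ^ (4 : ℝ) with hΛu
  have hΛu0 : 0 ≤ Λu := Real.rpow_nonneg hLc0 _
  have hB33 : 0 ≤ B₃ * B₃ * c := mul_nonneg (mul_nonneg hB₃ hB₃) hc
  set NP : ℝ := Real.sqrt (Fintype.card (P × P)) with hNP
  have hNP0 : 0 ≤ NP := Real.sqrt_nonneg _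
  have hm00 : (0 : ℝ) ≤ m := Nat.cast_nonneg m
  have hmN0 : (0 : ℝ) ≤ mN := Nat.cast_nonneg mN
  -- the uniform member constants: A′ = A(1 − κθc)⁻¹ ≦ 2A, θ·Mα₀ ≦ θ·a₁
  set Bm : ℝ := B₀ + κS * CR * (2 * A₀) * c + κS * (θD * a₁) * (2 * A₀) * c with hBm
  have hBm1 : 0 ≤ κS * CR * (2 * A₀) * c := mul_nonneg (mul_nonneg (mul_nonneg hκS0 hCR) (by linarith)) hc
  have hBm2 : 0 ≤ κS * (θD * a₁) * (2 * A₀) * c := mul_nonneg (mul_nonneg (mul_nonneg hκS0 (mul_nonneg hθD ha₁.le)) (by linarith)) hc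
  have hBm0 : 0 ≤ Bm := add_nonneg (add_nonneg hB₀ hBm1) hBm2
  set K₄u : ℝ := B₂ + B₂ * (θ₂ * a₁ * (2 * B₂) * c) * c with hK₄u
  have hK₄u0 : 0 ≤ K₄u := add_nonneg hB₂ (mul_nonneg (mul_nonneg hB₂ (mul_nonneg (mul_nonneg (mul_nonneg hθ₂ ha₁.le) (by linarith)) hc)) hc)
  set KLu : ℝ := Bm * Λu + Bm * Λu + (NP * K₄u + NP * K₄u * Λu + NP * K₄u * Λu) with hKLu
  have hKLu0 : 0 ≤ KLu := add_nonneg (add_nonneg (mul_nonneg hBm0 hΛu0) (mul_nonneg hBm0 hΛu0))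
    (add_nonneg (add_nonneg (mul_nonneg hNP0 hK₄u0) (mul_nonneg (mul_nonneg hNP0 hK₄u0) hΛu0)) (mul_nonneg (mul_nonneg hNP0 hK₄u0) hΛu0))
  set Fr : ℝ := (mN : ℝ) * m * Cev * CL ^ 2 * Real.exp (r * ρf) with hFr
  have hFr0 : 0 ≤ Fr := mul_nonneg (mul_nonneg (mul_nonneg (mul_nonneg hmN0 hm00) hCev) (sq_nonneg _)) (Real.exp_nonneg _)
  set BL2 : ℝ := max (Fr * KLu) 0 with hBL2
  have hBL20 : 0 ≤ BL2 := le_max_right _ _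
  set KHu : ℝ := 2 * (B₃ * B₃ * c) with hKHu
  have hKHu0 : 0 ≤ KHu := by positivity
  set BHm : ℝ := B₃ * B₃ * c + κS * CR * KHu * c + κS * (θD * a₁) * KHu * c with hBHm
  have hBHm1 : 0 ≤ κS * CR * KHu * c := mul_nonneg (mul_nonneg (mul_nonneg hκS0 hCR) hKHu0) hc
  have hBHm2 : 0 ≤ κS * (θD * a₁) * KHu * c := mul_nonneg (mul_nonneg (mul_nonneg hκS0 (mul_nonneg hθD ha₁.le)) hKHu0) hc
  have hBHm0 : 0 ≤ BHm := add_nonneg (add_nonneg hB33 hBHm1) hBHm2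
  set CH3 : ℝ := CL ^ 2 * Real.exp (r * ((1 - α) * ρ)) with hCH3
  have hCH30 : 0 ≤ CH3 := mul_nonneg (sq_nonneg _) (Real.exp_nonneg _)
  set tH : ℝ → ℝ := fun β => θH β * a₁ with htH
  have htH0 : ∀ β, 0 ≤ β → β < 1 → 0 ≤ tH β := fun β h0 h1 => mul_nonneg (hθH β h0 h1) ha₁.le
  set Bhu : ℝ → ℝ := fun β => Bh β + κS * tH β * (2 * A₀) * c with hBhu
  have hBhu0 : ∀ β, 0 ≤ β → β < 1 → 0 ≤ Bhu β := fun β h0 h1 =>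
    add_nonneg (hBh β h0 h1) (mul_nonneg (mul_nonneg (mul_nonneg hκS0 (htH0 β h0 h1)) (by linarith)) hc)
  set BβH : ℝ → ℝ := fun β => CH3 * ((Bq β * B₃ * c + κS * tH β * KHu * c) * Lc ^ (2 : ℝ)) with hBβH
  have hBβH0 : ∀ β, 0 ≤ β → β < 1 → 0 ≤ BβH β := fun β h0 h1 =>
    mul_nonneg hCH30 (mul_nonneg (add_nonneg (mul_nonneg (mul_nonneg (hBq β) hB₃) hc)
      (mul_nonneg (mul_nonneg (mul_nonneg hκS0 (htH0 β h0 h1)) hKHu0) hc)) hLc2)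
  set Bβo : ℝ → ℝ := fun β => max (max ((m : ℝ) * CL * Real.exp (r * ρf) * Bhu β) (BβH β)) 0 with hBβo
  have hBβo0 : ∀ β, 0 ≤ Bβo β := fun β => le_max_right _ _
  set Bεo : ℝ → ℝ := fun ε => max (Real.exp (r * ρf) * (Bi ε + κS * (θD * a₁) * (2 * AI ε) * c)) 0 with hBεo
  have hBεo0 : ∀ ε, 0 ≤ Bεo ε := fun ε => le_max_right _ _
  set Bεβo : ℝ → ℝ → ℝ := fun ε β => max (CL * Real.exp (r * ρf) * (Bi2 ε β + κS * tH β * (2 * AI (β + ε)) * c)) 0 with hBεβo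
  have hBεβo0 : ∀ ε β, 0 ≤ Bεβo ε β := fun ε β => le_max_right _ _
  -- the per-member assembly: members, H-words, pins and residual, all from the regular state
  have key : ∀ i, M₁' ≤ (geo i).M → ∀ α₀ : ℝ, 0 < α₀ → (geo i).M * α₀ ≤ a₁' →
      ∀ U : (bg i).Cfg, (bg i).Reg335 c35 α₀ U → (bg i).Reg336 c35 α₀ U →
        (∀ A ∈ [(𝔬 i).G U, (𝔬 i).G1 U],
          HasMajorant (g := toB6 (geo i) (R₀ i) (H₀ i)) (𝔬 i).blk A
            (fun a b => Bm * (geo i).len a ^ 2 * Real.exp (-(ρ * (geo i).dist a b))) ∧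
          HasMajorantHom (g := toB6 (geo i) (R₀ i) (H₀ i)) (𝔬 i).blk (𝔬 i).blkY ((𝔬 i).D U ∘ₗ A)
            (fun (a b : (geo i).Site) => Bm * (geo i).len a * Real.exp (-(ρ * (geo i).dist a b))) ∧
          HasMajorantHom (g := toB6 (geo i) (R₀ i) (H₀ i)) (𝔬 i).blkY (𝔬 i).blk (A ∘ₗ (𝔬 i).Dstar U)
            (fun (a b : (geo i).Site) => Bm * (geo i).len a * Real.exp (-(ρ * (geo i).dist a b)))) ∧
        (∀ Hop ∈ [(𝔬 i).Hm U, (𝔬 i).H1m U],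
          HasMaj (cNorm (R₀ i) (H₀ i) (𝔬 i).blkZ (hgeo i).lenle 2) (cNorm (R₀ i) (H₀ i) (𝔬 i).blk (hgeo i).lenle 2) Hop
            (fun a b => BHm * Real.exp (-(ρ * (geo i).dist a b))) ∧
          HasMaj (cNorm (R₀ i) (H₀ i) (𝔬 i).blkZ (hgeo i).lenle 2) (cNorm (R₀ i) (H₀ i) (𝔬 i).blkY (hgeo i).lenle 1) ((𝔬 i).D U ∘ₗ Hop)
            (fun a b => BHm * Real.exp (-(ρ * (geo i).dist a b)))) ∧
        ((∀ (K : B9.KernelFamily (geo i) (bg i)) (δ : ℝ), HasRWExpOfOps (𝔬 i) K U δ) ∧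
          (∀ (Hk' : B9.HKernel (geo i) (bg i)) (δ : ℝ), HasRWExpHOfOps (𝔬 i) Hk' U δ)) ∧
        ((∀ K ∈ [GD i, G₁ i], L2Block K BL2 ρf U ∧ B9.Ineq343_345 K Bβo Bεo Bεβo ρf U) ∧
          (∀ Hk' ∈ [Hk i, H₁k i], ∀ (β : ℝ) (ζ : (geo i).Cut) (y y' : (geo i).Site), 0 ≤ β → β < 1 → (geo i).cutInT ζ y →
            Hk'.h U β ζ y' ≤ Bβo β * (geo i).cutH β ζ * ((geo i).len y) ^ (-(1 + β)) * ((geo i).len y') ^ (-(d : ℝ)) *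
              Real.exp (-(ρf / 2 * (geo i).dist y y')))) := by
    intro i hM α₀ hα₀ hMa U hU hU'
    have hM₁i : M₁ ≤ (geo i).M := hle₁ hM
    have hMpos : 0 < (geo i).M := hM₁.trans_le hM₁i
    have hmα0 : 0 ≤ (geo i).M * α₀ := (mul_pos hMpos hα₀).le
    have hma₁ : (geo i).M * α₀ ≤ a₁ := hMa.trans ha₁'le
    have hmθ : (geo i).M * α₀ ≤ (2 * (κS * θS * c + 1))⁻¹ := hMa.trans ((min_le_right _ _).trans (min_le_left _ _))
    have hm₂ : (geo i).M * α₀ ≤ (2 * (B₂ * θ₂ * c * c + 1))⁻¹ := hMa.trans ((min_le_right _ _).trans (min_le_right _ _))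
    obtain ⟨hF, hI⟩ := hmodel i hM₁i α₀ hα₀ hma₁ U hU hU'
    have he1i := he1 i hM₁i α₀ hα₀ hma₁ U hU hU'
    have hLH := hlettersH i hM₁i α₀ hα₀ hma₁ U hU hU'
    obtain ⟨hH0, hL2s⟩ := hG0C i hM₁i α₀ hα₀ hma₁ U hU hU'
    have hStLi := hStL i hM₁i α₀ hα₀ hma₁ U hU hU'
    have hHH := hLHH i hM₁i α₀ hα₀ hma₁ U hU hU'
    obtain ⟨hS2, hSD, hPY, hPG0, hPQs, hRd2, hκ2, Λ₂, hΛ₂, hdom2⟩ := hstate2 i hM₁i α₀ hα₀ hma₁ U hU hU'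
    obtain ⟨hS1, hSDd, hPX, hPXd, hPDs, hPDds, hRd1, hκ1, Λ₁, hΛ₁, hdom1⟩ := hstate1 i hM₁i α₀ hα₀ hma₁ U hU hU'
    have hrowi := hrow i (hleL hM)
    obtain ⟨h260, -, hsize⟩ := hLg i (hleg hM)
    obtain ⟨⟨hlD0, hlD1, hlD2, hlD3, hlD4, hlD5⟩, ⟨hl10, hl11, hl12, hl13, hl14, hl15⟩⟩ := hl2N i U
    obtain ⟨hH1D, hH11⟩ := hH1N i U
    obtain ⟨hIRD, hIR1⟩ := hIF i U
    obtain ⟨hHC0, hHC1⟩ := hHCN i U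
    obtain ⟨⟨hsymG, hsymG1⟩, ⟨htrG, htrG1⟩⟩ := hsym i hM₁i α₀ hα₀ hma₁ U hU hU'
    have hlen := (hgeo i).lenle
    have hRd₂ : ∀ a b b' : (geo i).Site, Rel i b b' → (geo i).dist a b = (geo i).dist a b' := fun a b b' h => by
      rw [(hgeo i).symm a b, (hgeo i).symm a b', hRdist i b b' a h]
    -- the small factors of this member
    set θ : ℝ := θS * ((geo i).M * α₀) with hθdef
    set θ' : ℝ := θD * ((geo i).M * α₀) with hθ'def
    set θH' : ℝ → ℝ := fun β => θH β * ((geo i).M * α₀) with hθH'def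
    set θ₂' : ℝ := θ₂ * ((geo i).M * α₀) with hθ₂'def
    have hθ : 0 ≤ θ := mul_nonneg hθS hmα0
    have hθ' : 0 ≤ θ' := mul_nonneg hθD hmα0
    have hθH' : ∀ β, 0 ≤ β → β < 1 → 0 ≤ θH' β := fun β h0 h1 => mul_nonneg (hθH β h0 h1) hmα0
    have hθ₂' : 0 ≤ θ₂' := mul_nonneg hθ₂ hmα0
    have hθ'le : θ' ≤ θD * a₁ := mul_le_mul_of_nonneg_left hma₁ hθD
    have hθH'le : ∀ β, 0 ≤ β → β < 1 → θH' β ≤ tH β := fun β h0 h1 => mul_le_mul_of_nonneg_left hma₁ (hθH β h0 h1)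
    have hθ₂'le : θ₂' ≤ θ₂ * a₁ := mul_le_mul_of_nonneg_left hma₁ hθ₂
    -- κθc ≦ ½ on both states, B₂θ₂c² ≦ ½
    have hqS : κS * θ * c ≤ 1 / 2 := by
      have h := small_auxS hκθc hmθ
      calc κS * θ * c = κS * θS * c * ((geo i).M * α₀) := by rw [hθdef]; ring
        _ ≤ 1 / 2 := h
    have hq2 : (𝔖₂ i U).κ * θ * c ≤ 1 / 2 :=
      (mul_le_mul_of_nonneg_right (mul_le_mul_of_nonneg_right hκ2 hθ) hc).trans hqS
    have hq1 : (𝔖₁ i U).κ * θ * c ≤ 1 / 2 :=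
      (mul_le_mul_of_nonneg_right (mul_le_mul_of_nonneg_right hκ1 hθ) hc).trans hqS
    have hq2lt : (𝔖₂ i U).κ * θ * c < 1 := lt_one_of_le_half hq2
    have hq1lt : (𝔖₁ i U).κ * θ * c < 1 := lt_one_of_le_half hq1
    have hinv2 : (1 - (𝔖₂ i U).κ * θ * c)⁻¹ ≤ 2 := inv_one_sub_le_two hq2
    have hinv1 : (1 - (𝔖₁ i U).κ * θ * c)⁻¹ ≤ 2 := inv_one_sub_le_two hq1
    have hinv20 : 0 ≤ (1 - (𝔖₂ i U).κ * θ * c)⁻¹ := inv_nonneg.mpr (sub_nonneg.mpr hq2lt.le)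
    have hinv10 : 0 ≤ (1 - (𝔖₁ i U).κ * θ * c)⁻¹ := inv_nonneg.mpr (sub_nonneg.mpr hq1lt.le)
    have hq₂ : B₂ * θ₂' * c * c ≤ 1 / 2 := by
      have h := small_auxS hB₂c hm₂
      calc B₂ * θ₂' * c * c = B₂ * θ₂ * c * c * ((geo i).M * α₀) := by rw [hθ₂'def]; ring
        _ ≤ 1 / 2 := h
    have hq₂1 : B₂ * θ₂' * c * c < 1 := lt_one_of_le_half hq₂
    -- rates: the two-stage compositions run at ρ₁ = ρ + σ then ρ
    have hρ0 : 0 ≤ ρ := hρ.le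
    have hρ₁0 : 0 ≤ ρ + σ := add_nonneg hρ0 hσ
    have hρ₁S : ρ + σ ≤ δ₀ := by linarith only [hρS, hσ]
    have hρ₁K : ρ + σ + σ ≤ δK := by linarith only [hρδ]
    have hρ₁3 : ρ + σ + σ ≤ δ₃ := by linarith only [hρ₃]
    have hρS' : ρ ≤ δ₀ := by linarith only [hρS, hσ]
    have hρK' : ρ + σ ≤ δK := by linarith only [hρδ, hσ]
    have hρ3' : ρ + σ ≤ δ₃ := by linarith only [hρ₃, hσ]
    have hρKle : ρ ≤ δK := by linarith only [hρδ, hσ]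
    have hαρ : 0 ≤ α * ρ := mul_nonneg hα0 hρ0
    have hρfρ : ρf ≤ ρ := by linarith only [hρf2, hσ, hαρ]
    have hexpf : ∀ y y' : (geo i).Site, Real.exp (-(ρ * (geo i).dist y y')) ≤ Real.exp (-(ρf * (geo i).dist y y')) := fun y y' =>
      Real.exp_le_exp.mpr (neg_le_neg (mul_le_mul_of_nonneg_right hρfρ ((hgeo i).dnn y y')))
    -- the resolvent identities
    have hfix := fix_of_inverses hI.invG0' hI.invG
    have hfix1 := fix_of_inverses hI.invG0' hI.invG1
    have hκ20 : 0 ≤ (𝔖₂ i U).κ := (𝔖₂ i U).κ_nonneg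
    have hκ10 : 0 ≤ (𝔖₁ i U).κ := (𝔖₁ i U).κ_nonneg
    have hdomX' := fun ε (hε : 0 < ε) => (hdomX i ε hε).1
    have hlocX' := fun ε (hε : 0 < ε) => (hdomX i ε hε).2
    -- RIGHT ENTRIES IN THE STATES (g26 `hasMaj_right_of_stepS`), for a step `hK` at θ and A with A = G₀ + G₀TA
    have rightId : ∀ {A T : Module.End ℝ (X i → ℝ)}, A = (𝔬 i).G0 U + (𝔬 i).G0 U ∘ₗ T ∘ₗ A →
        HasMaj (𝔖₂ i U) (𝔖₂ i U) ((𝔬 i).G0 U ∘ₗ T) (fun a b => θ * Real.exp (-(δK * (geo i).dist a b))) →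
        HasMaj (cNorm (R₀ i) (H₀ i) (𝔬 i).blk (hgeo i).lenle 0) (𝔖₂ i U) A
          (fun a b => 2 * A₀ * Real.exp (-((ρ + σ) * (geo i).dist a b))) := by
      intro A T hfx hK
      obtain ⟨M₀, hM₀, hap⟩ := exists_hasMaj_const_of_dom (hgeo i) (𝔬 i).blk (𝔬 i).blk 0 hΛ₂ hdom2 (A ∘ₗ LinearMap.id)
      have hS : HasMaj (cNorm (R₀ i) (H₀ i) (𝔬 i).blk (hgeo i).lenle 0) (𝔖₂ i U) ((𝔬 i).G0 U ∘ₗ LinearMap.id)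
          (fun a b => A₀ * Real.exp (-(δ₀ * (geo i).dist a b))) := by rw [LinearMap.comp_id]; exact hPG0
      have h := hasMaj_right_of_stepS (hgeo i) hrowi hθ hA₀ hM₀ hρ₁0 hρ₁S hρ₁K hK hS hfx hap hq2lt
      rw [LinearMap.comp_id] at h
      refine h.mono fun a b => mul_le_mul_of_nonneg_right ?_ (Real.exp_nonneg _)
      calc A₀ * (1 - (𝔖₂ i U).κ * θ * c)⁻¹ ≤ A₀ * 2 := mul_le_mul_of_nonneg_left hinv2 hA₀
        _ = 2 * A₀ := by ring
    have rightDs : ∀ {A T : Module.End ℝ (X i → ℝ)}, A = (𝔬 i).G0 U + (𝔬 i).G0 U ∘ₗ T ∘ₗ A →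
        HasMaj (𝔖₁ i U) (𝔖₁ i U) ((𝔬 i).G0 U ∘ₗ T) (fun a b => θ * Real.exp (-(δK * (geo i).dist a b))) →
        HasMaj (cNormR (R₀ i) (H₀ i) (𝔬 i).blkY (hgeo i).lenle 0) (𝔖₁ i U) (A ∘ₗ (𝔬 i).Dstar U)
          (fun a b => 2 * A₀ * Real.exp (-((ρ + σ) * (geo i).dist a b))) := by
      intro A T hfx hK
      obtain ⟨M₀, hM₀, hap⟩ := exists_hasMaj_const_of_dom (hgeo i) (𝔬 i).blkY (𝔬 i).blk 0 hΛ₁ hdom1 (A ∘ₗ (𝔬 i).Dstar U)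
      have hap' : HasMaj (cNormR (R₀ i) (H₀ i) (𝔬 i).blkY (hgeo i).lenle 0) (𝔖₁ i U) (A ∘ₗ (𝔬 i).Dstar U) (fun _ _ => M₀) := by
        have h := hasMaj_toR_src (hgeo i) hap
        rwa [Nat.cast_zero, neg_zero] at h
      have h := hasMaj_right_of_stepS (hgeo i) hrowi hθ hA₀ hM₀ hρ₁0 hρ₁S hρ₁K hK hPDs hfx hap' hq1lt
      refine h.mono fun a b => mul_le_mul_of_nonneg_right ?_ (Real.exp_nonneg _)
      calc A₀ * (1 - (𝔖₁ i U).κ * θ * c)⁻¹ ≤ A₀ * 2 := mul_le_mul_of_nonneg_left hinv1 hA₀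
        _ = 2 * A₀ := by ring
    have rightDds : ∀ {A T : Module.End ℝ (X i → ℝ)}, A = (𝔬 i).G0 U + (𝔬 i).G0 U ∘ₗ T ∘ₗ A →
        HasMaj (𝔖₁ i U) (𝔖₁ i U) ((𝔬 i).G0 U ∘ₗ T) (fun a b => θ * Real.exp (-(δK * (geo i).dist a b))) →
        ∀ (μ : P) (ε : ℝ), 0 < ε →
          HasMaj (bHX i ε) (𝔖₁ i U) (A ∘ₗ Dds i U μ) (fun a b => 2 * AI ε * Real.exp (-((ρ + σ) * (geo i).dist a b))) := by
      intro A T hfx hK μ ε hε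
      obtain ⟨M₀, hM₀, hap⟩ := exists_hasMaj_const_of_dom_src (hgeo i) (𝔬 i).blk (𝔬 i).blk (hdomX' ε hε) (hlocX' ε hε) hΛ₁ hdom1
        (A ∘ₗ Dds i U μ)
      have h := hasMaj_right_of_stepS (hgeo i) hrowi hθ (hAI ε hε) hM₀ hρ₁0 hρ₁S hρ₁K hK (hPDds μ ε hε) hfx hap hq1lt
      refine h.mono fun a b => mul_le_mul_of_nonneg_right ?_ (Real.exp_nonneg _)
      calc AI ε * (1 - (𝔖₁ i U).κ * θ * c)⁻¹ ≤ AI ε * 2 := mul_le_mul_of_nonneg_left hinv1 (hAI ε hε)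
        _ = 2 * AI ε := by ring
    have rightH : ∀ {A T : Module.End ℝ (X i → ℝ)} {Cop : Module.End ℝ (Z i → ℝ)}, A = (𝔬 i).G0 U + (𝔬 i).G0 U ∘ₗ T ∘ₗ A →
        HasMaj (𝔖₂ i U) (𝔖₂ i U) ((𝔬 i).G0 U ∘ₗ T) (fun a b => θ * Real.exp (-(δK * (geo i).dist a b))) →
        HasMaj (cNorm (R₀ i) (H₀ i) (𝔬 i).blkZ (hgeo i).lenle 2) (bZ i) Cop (fun a b => B₃ * Real.exp (-(δ₃ * (geo i).dist a b))) →
        HasMaj (cNorm (R₀ i) (H₀ i) (𝔬 i).blkZ (hgeo i).lenle 2) (𝔖₂ i U) (A ∘ₗ ((𝔬 i).Qstar U ∘ₗ Cop))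
          (fun a b => KHu * Real.exp (-((ρ + σ) * (geo i).dist a b))) := by
      intro A T Cop hfx hK hCop
      obtain ⟨M₀, hM₀, hap⟩ := exists_hasMaj_const_of_dom (hgeo i) (𝔬 i).blkZ (𝔬 i).blk 2 hΛ₂ hdom2 (A ∘ₗ ((𝔬 i).Qstar U ∘ₗ Cop))
      have h := H_entry0_of_stateS (hgeo i) hrowi (hκZ i) hc hθ hB₃ hM₀ hσ hρ₁0 hρ₁3 hρ₁K hK hPQs hCop hfx hap hq2lt
      refine h.mono fun a b => mul_le_mul_of_nonneg_right ?_ (Real.exp_nonneg _)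
      calc B₃ * B₃ * c * (1 - (𝔖₂ i U).κ * θ * c)⁻¹ ≤ B₃ * B₃ * c * 2 := mul_le_mul_of_nonneg_left hinv2 hB33
        _ = KHu := by rw [hKHu]; ring
    -- THE MEMBERS AND BLOCKS OF A ∈ {G, G₁} (g27 `B9Thm312WholeMembersRegular`, `…BlocksRegular`, `…LeafBlocksRegular`) with the uniform constants
    have h2A₀ : 0 ≤ 2 * A₀ := by linarith only [hA₀]
    have hL0i : 0 < (geo i).L := lt_of_lt_of_le one_pos (hL1 i)
    have hL4 : (geo i).L ^ (4 : ℝ) ≤ Λu := Real.rpow_le_rpow hL0i.le (hLle i) (by norm_num)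
    have hST : ∀ γ : ℝ, |γ| ≤ 4 → ScaleTransfer (geo i) ρ α ((geo i).L ^ |γ|) (fun y => (geo i).len y ^ γ) ∧
        0 ≤ (geo i).L ^ |γ| ∧ (geo i).L ^ |γ| ≤ Λu := fun γ hγ =>
      ⟨scaleTransfer_rpow_of_260 h260 hsize (hL1 i) (hη i) γ hγ, Real.rpow_nonneg hL0i.le _,
        (B9Ineq347AllEntries.size_condition_compact (geo i).L γ _ (hL1 i) hγ hsize).2.trans hL4⟩
    obtain ⟨hST1, hΛ₁0, hΛ₁le⟩ := hST 1 (by norm_num)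
    obtain ⟨hSTh, hΛh0, hΛhle⟩ := hST (1 / 2) (by rw [abs_of_nonneg (by norm_num : (0 : ℝ) ≤ 1 / 2)]; norm_num)
    obtain ⟨hSTm, hΛm0, hΛmle⟩ := hST (-1) (by norm_num)
    have hST2 : ScaleTransfer (geo i) ρ α (Lc ^ (2 : ℝ)) (fun y => (geo i).len y ^ (2 : ℝ)) := by
      obtain ⟨h2, _, _⟩ := hST 2 (by norm_num)
      have hΛle : (geo i).L ^ |(2 : ℝ)| ≤ Lc ^ (2 : ℝ) := by
        rw [abs_of_pos (by norm_num : (0 : ℝ) < 2)]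
        exact Real.rpow_le_rpow hL0i.le (hLle i) (by norm_num)
      exact fun y y' => (h2 y y').trans (mul_le_mul_of_nonneg_right hΛle (B9Ineq347AllEntries.weight_nonneg (geo i) hL0i (hη i) 2 y))
    have hK₄le : B₂ + B₂ * (θ₂' * (B₂ * (1 - B₂ * θ₂' * c * c)⁻¹) * c) * c ≤ K₄u := by
      have h1 : B₂ * (1 - B₂ * θ₂' * c * c)⁻¹ ≤ 2 * B₂ := const_le_two_mul hB₂ hq₂
      have h0 : 0 ≤ B₂ * (1 - B₂ * θ₂' * c * c)⁻¹ := mul_nonneg hB₂ (inv_nonneg.mpr (by linarith only [hq₂1]))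
      have h2 : θ₂' * (B₂ * (1 - B₂ * θ₂' * c * c)⁻¹) * c ≤ θ₂ * a₁ * (2 * B₂) * c :=
        mul_le_mul_of_nonneg_right (mul_le_mul hθ₂'le h1 h0 (mul_nonneg hθ₂ ha₁.le)) hc
      have h3 : B₂ * (θ₂' * (B₂ * (1 - B₂ * θ₂' * c * c)⁻¹) * c) * c ≤ B₂ * (θ₂ * a₁ * (2 * B₂) * c) * c :=
        mul_le_mul_of_nonneg_right (mul_le_mul_of_nonneg_left h2 hB₂) hc
      rw [hK₄u]; linarith only [h3]
    have hK₄0 : 0 ≤ B₂ + B₂ * (θ₂' * (B₂ * (1 - B₂ * θ₂' * c * c)⁻¹) * c) * c :=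
      add_nonneg hB₂ (mul_nonneg (mul_nonneg hB₂ (mul_nonneg (mul_nonneg hθ₂'
        (mul_nonneg hB₂ (inv_nonneg.mpr (by linarith only [hq₂1])))) hc)) hc)
    have hBΛ : 0 ≤ Bm * Λu := mul_nonneg hBm0 hΛu0
    have hNK : 0 ≤ NP * K₄u := mul_nonneg hNP0 hK₄u0
    have hNKΛ : 0 ≤ NP * K₄u * Λu := mul_nonneg hNK hΛu0
    have hKLa : Bm * (geo i).L ^ |(1 : ℝ)| ≤ KLu := by
      have h := mul_le_mul_of_nonneg_left hΛ₁le hBm0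
      rw [hKLu]; linarith only [h, hBΛ, hNK, hNKΛ]
    have hKLb : Bm * (geo i).L ^ |(1 / 2 : ℝ)| ≤ KLu := by
      have h := mul_le_mul_of_nonneg_left hΛhle hBm0
      rw [hKLu]; linarith only [h, hBΛ, hNK, hNKΛ]
    have hKL3 : NP * (B₂ + B₂ * (θ₂' * (B₂ * (1 - B₂ * θ₂' * c * c)⁻¹) * c) * c) ≤ KLu := by
      have h := mul_le_mul_of_nonneg_left hK₄le hNP0
      rw [hKLu]; linarith only [h, hBΛ, hNK, hNKΛ]
    have hKL3' : NP * (B₂ + B₂ * (θ₂' * (B₂ * (1 - B₂ * θ₂' * c * c)⁻¹) * c) * c) * (geo i).L ^ |(1 : ℝ)| ≤ KLu := by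
      have h := mul_le_mul (mul_le_mul_of_nonneg_left hK₄le hNP0) hΛ₁le hΛ₁0 hNK
      rw [hKLu]; linarith only [h, hBΛ, hNK, hNKΛ]
    have hKL5 : NP * (B₂ + B₂ * (θ₂' * (B₂ * (1 - B₂ * θ₂' * c * c)⁻¹) * c) * c) * (geo i).L ^ |(-1 : ℝ)| ≤ KLu := by
      have h := mul_le_mul (mul_le_mul_of_nonneg_left hK₄le hNP0) hΛmle hΛm0 hNK
      rw [hKLu]; linarith only [h, hBΛ, hNK, hNKΛ]
    have hKL2 : (mN : ℝ) * m * Cev * CL ^ 2 * Real.exp (r * ρf) * KLu ≤ BL2 := le_max_left _ _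
    have hc0le : (𝔖₂ i U).κ * CR * (2 * A₀) * c ≤ Bm := by
      have h1 : (𝔖₂ i U).κ * CR * (2 * A₀) * c ≤ κS * CR * (2 * A₀) * c :=
        mul_le_mul_of_nonneg_right (mul_le_mul_of_nonneg_right (mul_le_mul_of_nonneg_right hκ2 hCR) h2A₀) hc
      rw [hBm]; linarith only [h1, hB₀, hBm2]
    have hc1le : B₀ + (𝔖₂ i U).κ * θ' * (2 * A₀) * c ≤ Bm := by
      have h1 : (𝔖₂ i U).κ * θ' * (2 * A₀) * c ≤ κS * (θD * a₁) * (2 * A₀) * c :=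
        mul_le_mul_of_nonneg_right (mul_le_mul_of_nonneg_right (mul_le_mul hκ2 hθ'le hθ' hκS0) h2A₀) hc
      rw [hBm]; linarith only [h1, hBm1]
    have hc2le : (𝔖₁ i U).κ * CR * (2 * A₀) * c ≤ Bm := by
      have h1 : (𝔖₁ i U).κ * CR * (2 * A₀) * c ≤ κS * CR * (2 * A₀) * c :=
        mul_le_mul_of_nonneg_right (mul_le_mul_of_nonneg_right (mul_le_mul_of_nonneg_right hκ1 hCR) h2A₀) hc
      rw [hBm]; linarith only [h1, hB₀, hBm2]
    have hAI2 : ∀ ε, 0 < ε → 0 ≤ 2 * AI ε := fun ε hε => by have := hAI ε hε; linarith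
    -- the two families: G (T = Δ′_π) and G₁ (T = Δ′_π + Δ⁽²⁾_π), BOTH over the regular state (`…LeafBlocksRegular.blocks_of_state_pairM`)
    have blocksG := blocks_of_state_pairM (hgeo i) (K := GD i) (𝔬 i) (𝔭 i) (Dd i) (Dds i) (bHX i) (Rel i) (ev i) (evY i) hrowi hc hθ' hθH' hθ₂'
      h2A₀ hAI2 hB₀ hB₂ hCR hBm0 hκ2 hκ1 hσ hα0 hρ0 hρS' (le_add_of_nonneg_right hσ) hρK' hρ₁S hq₂1 hρf.le hρf1 hρf2 hBh hBi hBi2 hΛ₁0 hΛm0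
      hST1 hSTh hSTm hfix he1i hH0 hL2s hStLi.t (rightId hfix hS2.step) (rightDs hfix hS1.step) (rightDds hfix hS1.step) hRd2 hRd1 hSD.1
      (fun β h0 h1 => (hPY β h0 h1).1) (fun ν => (hSDd ν).1) (fun β h0 h1 => (hPX β h0 h1).1) (fun ν β h0 h1 => (hPXd ν β h0 h1).1)
      hc0le hc1le hc2le hKLu0 hKLa hKLb hKL3 hKL3' hKL5 hsymG htrG hRd₂ (hmult i) (hnbr i) hCL1 (hCL i) hCev hlD0 hlD1 hlD2 hlD3 hlD4 hlD5 hH1D hIRD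
    have blocksG1 := blocks_of_state_pairM (hgeo i) (K := G₁ i) (𝔬 i) (𝔭 i) (Dd i) (Dds i) (bHX i) (Rel i) (ev i) (evY i) hrowi hc hθ' hθH' hθ₂'
      h2A₀ hAI2 hB₀ hB₂ hCR hBm0 hκ2 hκ1 hσ hα0 hρ0 hρS' (le_add_of_nonneg_right hσ) hρK' hρ₁S hq₂1 hρf.le hρf1 hρf2 hBh hBi hBi2 hΛ₁0 hΛm0
      hST1 hSTh hSTm hfix1 he1i hH0 hL2s hStLi.t1 (rightId hfix1 hS2.step1) (rightDs hfix1 hS1.step1) (rightDds hfix1 hS1.step1) hRd2 hRd1 hSD.2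
      (fun β h0 h1 => (hPY β h0 h1).2) (fun ν => (hSDd ν).2) (fun β h0 h1 => (hPX β h0 h1).2) (fun ν β h0 h1 => (hPXd ν β h0 h1).2)
      hc0le hc1le hc2le hKLu0 hKLa hKLb hKL3 hKL3' hKL5 hsymG1 htrG1 hRd₂ (hmult i) (hnbr i) hCL1 (hCL i) hCev hl10 hl11 hl12 hl13 hl14 hl15 hH11 hIR1
    -- the residual at the uniform families
    have hmCE : 0 ≤ (m : ℝ) * CL * Real.exp (r * ρf) := mul_nonneg (mul_nonneg hm00 (zero_le_one.trans hCL1)) (Real.exp_nonneg _)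
    have weak : ∀ {K : B9.KernelFamily (geo i) (bg i)},
        L2Block K ((mN : ℝ) * m * Cev * CL ^ 2 * Real.exp (r * ρf) * KLu) ρf U →
        B9.Ineq343_345 K (fun β => m * CL * Real.exp (r * ρf) * (Bh β + κS * θH' β * (2 * A₀) * c))
          (fun ε => Real.exp (r * ρf) * (Bi ε + κS * θ' * (2 * AI ε) * c))
          (fun ε β => CL * Real.exp (r * ρf) * (Bi2 ε β + κS * θH' β * (2 * AI (β + ε)) * c)) ρf U →
        L2Block K BL2 ρf U ∧ B9.Ineq343_345 K Bβo Bεo Bεβo ρf U := by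
      intro K hl2 hho
      refine ⟨l2Block_mono (S i) hl2 hKL2 hBL20 le_rfl, ineq343_345_mono_on (S i) hho (hgeo i).lenpos ?_ ?_ ?_ le_rfl⟩
      · intro β h0 h1
        refine ⟨le_trans ?_ ((le_max_left _ _).trans (le_max_left _ _)), hBβo0 β⟩
        refine mul_le_mul_of_nonneg_left ?_ hmCE
        have h2 : κS * θH' β * (2 * A₀) * c ≤ κS * tH β * (2 * A₀) * c :=
          mul_le_mul_of_nonneg_right (mul_le_mul_of_nonneg_right (mul_le_mul_of_nonneg_left (hθH'le β h0 h1) hκS0) h2A₀) hc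
        simp only [hBhu]; linarith only [h2]
      · intro ε hε hε1
        refine ⟨le_trans ?_ (le_max_left _ _), hBεo0 ε⟩
        refine mul_le_mul_of_nonneg_left ?_ (Real.exp_nonneg _)
        have h2 : κS * θ' * (2 * AI ε) * c ≤ κS * (θD * a₁) * (2 * AI ε) * c :=
          mul_le_mul_of_nonneg_right (mul_le_mul_of_nonneg_right (mul_le_mul_of_nonneg_left hθ'le hκS0) (hAI2 ε hε)) hc
        linarith only [h2]
      · intro ε β hε hε1 h0 h1
        refine ⟨le_trans ?_ (le_max_left _ _), hBεβo0 ε β⟩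
        refine mul_le_mul_of_nonneg_left ?_ (mul_nonneg (zero_le_one.trans hCL1) (Real.exp_nonneg _))
        have h2 : κS * θH' β * (2 * AI (β + ε)) * c ≤ κS * tH β * (2 * AI (β + ε)) * c :=
          mul_le_mul_of_nonneg_right (mul_le_mul_of_nonneg_right (mul_le_mul_of_nonneg_left (hθH'le β h0 h1) hκS0) (hAI2 (β + ε) (by linarith only [h0, hε]))) hc
        linarith only [h2]
    have resG : _ ∧ (L2Block (GD i) BL2 ρf U ∧ B9.Ineq343_345 (GD i) Bβo Bεo Bεβo ρf U) := ⟨blocksG.1, weak blocksG.2.1 blocksG.2.2⟩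
    have resG1 : _ ∧ (L2Block (G₁ i) BL2 ρf U ∧ B9.Ineq343_345 (G₁ i) Bβo Bεo Bεβo ρf U) := ⟨blocksG1.1, weak blocksG1.2.1 blocksG1.2.2⟩
    -- THE H-WORDS THROUGH THE STATE (`…LeafBlocksRegular.hwords_uniform_of_state`): H = A∘(Q*C) INTO 𝔖₂ (`rightH`), read back, ∇_UH, (3.133)
    have hBH0le : (𝔖₂ i U).κ * CR * KHu * c ≤ BHm := by
      have h1 : (𝔖₂ i U).κ * CR * KHu * c ≤ κS * CR * KHu * c :=
        mul_le_mul_of_nonneg_right (mul_le_mul_of_nonneg_right (mul_le_mul_of_nonneg_right hκ2 hCR) hKHu0) hc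
      rw [hBHm]; linarith only [h1, hB33, hBHm2]
    have hBH1le : B₃ * B₃ * c + (𝔖₂ i U).κ * θ' * KHu * c ≤ BHm := by
      have h1 : (𝔖₂ i U).κ * θ' * KHu * c ≤ κS * (θD * a₁) * KHu * c :=
        mul_le_mul_of_nonneg_right (mul_le_mul_of_nonneg_right (mul_le_mul hκ2 hθ'le hθ' hκS0) hKHu0) hc
      rw [hBHm]; linarith only [h1, hBHm1]
    have hCβle : ∀ β, 0 ≤ β → β < 1 →
        CL ^ 2 * Real.exp (r * ((1 - α) * ρ)) * ((Bq β * B₃ * c + (𝔖₂ i U).κ * θH' β * KHu * c) * Lc ^ (2 : ℝ)) ≤ Bβo β := by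
      intro β h0 h1
      have h2 : (𝔖₂ i U).κ * θH' β * KHu * c ≤ κS * tH β * KHu * c :=
        mul_le_mul_of_nonneg_right (mul_le_mul_of_nonneg_right (mul_le_mul hκ2 (hθH'le β h0 h1) (hθH' β h0 h1) hκS0) hKHu0) hc
      have h3 : (Bq β * B₃ * c + (𝔖₂ i U).κ * θH' β * KHu * c) * Lc ^ (2 : ℝ) ≤ (Bq β * B₃ * c + κS * tH β * KHu * c) * Lc ^ (2 : ℝ) :=
        mul_le_mul_of_nonneg_right (by linarith only [h2]) hLc2
      exact ((mul_le_mul_of_nonneg_left h3 hCH30).trans (le_max_right _ _)).trans (le_max_left _ _)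
    have hδhalf : ρf / 2 ≤ (1 - α) * ρ := by linarith only [hρf1, hσ, hρf.le]
    have resH := hwords_uniform_of_state (hgeo i) (S i) (𝔬 i) (𝔭 i) hrowi (hκZ i) hc hθ' hθH' hKHu0 hCR hB₃ hBq hLc2 hσ hρ0
      (le_add_of_nonneg_right hσ) hρ₁S hρ₁3 hρK' (by linarith only [hα]) hδhalf hBH0le hBH1le hCβle hBβo0 hI.eq126 hfix (by rw [hI.eq126]; exact rightH hfix hS2.step hLH.c2) hRd2 hSD.1
      (fun β h0 h1 => (hPY β h0 h1).1) hLH.dgQs hLH.c2 hHH.pQ hHC0 hCL1 (hCL i) hST2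
    have resH1 := hwords_uniform_of_state (hgeo i) (S i) (𝔬 i) (𝔭 i) hrowi (hκZ i) hc hθ' hθH' hKHu0 hCR hB₃ hBq hLc2 hσ hρ0
      (le_add_of_nonneg_right hσ) hρ₁S hρ₁3 hρK' (by linarith only [hα]) hδhalf hBH0le hBH1le hCβle hBβo0 hI.eq129 hfix1 (by rw [hI.eq129]; exact rightH hfix1 hS2.step1 hLH.c12) hRd2 hSD.2
      (fun β h0 h1 => (hPY β h0 h1).2) hLH.dgQs hLH.c12 hHH.pQ hHC1 hCL1 (hCL i) hST2
    -- THE PINS: the series over the regular state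
    obtain ⟨MG, hMG, hapG⟩ := exists_hasMaj_const_of_dom (hgeo i) (𝔬 i).blk (𝔬 i).blk 0 hΛ₂ hdom2 ((𝔬 i).G U)
    obtain ⟨MG1, hMG1, hapG1⟩ := exists_hasMaj_const_of_dom (hgeo i) (𝔬 i).blk (𝔬 i).blk 0 hΛ₂ hdom2 ((𝔬 i).G1 U)
    have hσK : σ ≤ δK := by linarith only [hρδ, hρ0, hσ]
    have hσ0 : σ ≤ δ₀ := by linarith only [hρS, hρ0, hσ]
    have hRW := hasRWExp_of_stepS (hgeo i) hrowi hθ hσK hσ0 hMG hMG1 hCR hq2lt hS2 hI hapG hapG1 hRd2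
    have hRWH := hasRWExpH_of_stepS (hgeo i) hrowi hθ hσK hσ0 hMG hMG1 hCR hq2lt hS2 hI hapG hapG1 hRd2
    -- assembling the per-member statement
    refine ⟨fun A hA => ?_, fun Hop hHop => ?_, ⟨hRW, hRWH⟩, fun K hK => ?_, fun Hk' hK' => ?_⟩
    · have hA2 : A = (𝔬 i).G U ∨ A = (𝔬 i).G1 U := by simpa using hA
      rcases hA2 with rfl | rfl
      · exact resG.1
      · exact resG1.1
    · have hH2 : Hop = (𝔬 i).Hm U ∨ Hop = (𝔬 i).H1m U := by simpa using hHop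
      rcases hH2 with rfl | rfl
      · exact resH.1
      · exact resH1.1
    · have hK2 : K = GD i ∨ K = G₁ i := by simpa using hK
      rcases hK2 with rfl | rfl
      · exact resG.2
      · exact resG1.2
    · have hK2 : Hk' = Hk i ∨ Hk' = H₁k i := by simpa using hK'
      rcases hK2 with rfl | rfl
      · exact resH.2
      · exact resH1.2
  exact thm312Printed_of_membersRelHZ 𝔬 R₀ H₀ GD G₁ Hk H₁k ev evY Rel m r₁ ρ a₁' M₁' BL2 ρf Bm BHm α Lc Bβo Bεo Bεβo
    hr₁ hρ ha₁'pos hM₁'pos hρf hBm0 hBHm0 hα hBβo0 hBεo0 hBεβo0 hgeo S hL1 hLle hη hL21 hsat hmult hRdist hRlen hcoR hco1R hcoHR hcoG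
    (fun i hM α₀ hα₀ hMa U hU hU' => hmodel i (hle₁ hM) α₀ hα₀ (hMa.trans ha₁'le) U hU hU')
    (fun i hM α₀ hα₀ hMa U hU hU' => (key i hM α₀ hα₀ hMa U hU hU').1)
    (fun i hM α₀ hα₀ hMa U hU hU' => (key i hM α₀ hα₀ hMa U hU hU').2.1)
    (fun i hM α₀ hα₀ hMa U hU hU' => (key i hM α₀ hα₀ hMa U hU hU').2.2.1)
    (fun i hM α₀ hα₀ hMa U hU hU' => (key i hM α₀ hα₀ hMa U hU hU').2.2.2)

end Family

end

end Literature.MathematicalPhysics.QuantumFieldTheory.Balaban1983to89.B9Thm312WholeLeafCompletePairMBZS
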